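import Literature.NumberTheory.Transcendental.BrownLinearIndependence
import HarnessLib

/-!
# Brown, *Mixed Tate motives over ℤ* (2012) — consistency of the abstract level data: the free
# (deconcatenation) model

Sibling file of `BrownLinearIndependence`. The structure `Brown2012.LevelData` axiomatizes what
Brown's proof of Theorem 7.4 uses of the motivic derivations (Lemma 3.4, Lemma 5.5, Theorem 6.1).
This file shows that these axioms are CONSISTENT — and exercises the definitions `ColWord`, `phi`,
`deconcEntry`, `levelMatrix`, `levelSpan` against each other — by constructing the **free model**:
`H = ℚ^{(List ℕ)}` (the free vector space on all indices), `z w = e_w`, and `D r` the deconcatenation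
operator of Theorem 6.1 itself, `D r (e_w) = ∑_{w = uv, deg₃ v = 1, |v| = 2r+1} c_v e_u` on Hoffman
words of level `≥ 1` and `0` otherwise (`Brown2012.freeD`), with `E = 0`:

* `Brown2012.freeLevelData : LevelData` — all fields hold (level lowering by construction; the
  matrix identity of Theorem 6.1 exactly; `e_{2ⁿ} ≠ 0`);
* hence (Theorem 7.4 applied to it, `LevelData.linearIndependent_hoffman`) the `e_w` are
  independent — trivially true here, the point being that the hypotheses of Theorem 7.4 are
  satisfiable and correctly wired (`Brown2012.freeLevelData_linearIndependent`).

(`Brown2012.MotivicData`, which adds the dimension bound `dim V_N ≤ d_N`, is of course NOT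
inhabited by the free model: it implies the named fact `hoffmanSpan_eq_mzvSpace`.)
No named facts are introduced (D-0026).

## References

* F. Brown, *Mixed Tate motives over ℤ*, Ann. of Math. **175** (2012), 949–976, Theorem 6.1 and
  §7.2. [Brown2012]
-/

noncomputable section

open scoped BigOperators

namespace Literature.NumberTheory.Transcendental

namespace Brown2012

open MZV

/-- The deconcatenation operator on a basis vector, with the weight and level of the word made
explicit: `∑_{u ∈ B'_{N,ℓ}, |u| + 2r + 1 = N} (T_{N,ℓ})_{w,u} e_u`
(`(T)_{w,u} = deconcEntry w u`). [cite: Brown2012, Theorem 6.1] -/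
def freeDAux (N ℓ r : ℕ) (w : List ℕ) : List ℕ →₀ ℚ :=
  ∑ u ∈ Finset.univ.filter (fun u : ColWord N ℓ => weight u.1 + (2 * r + 1) = N),
    deconcEntry w u.1 • Finsupp.single u.1 (1 : ℚ)

/-- The free model's `D r` on the basis vector `e_w`: deconcatenation (Theorem 6.1) on Hoffman words
of level `≥ 1`, zero otherwise. [cite: Brown2012, Theorem 6.1] -/
def freeD (r : ℕ) (w : List ℕ) : List ℕ →₀ ℚ :=
  if IsHoffman w ∧ 1 ≤ level w then freeDAux (weight w) (level w) r w else 0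

/-- On a row word `w = u' 3 2^{r'-1}` of `B_{N,ℓ}` the free `D r` is the row of `T_{N,ℓ}`.
[cite: Brown2012, Theorem 6.1] -/
theorem freeD_phi {N ℓ : ℕ} (hℓ : 1 ≤ ℓ) (u' : ColWord N ℓ) (r : ℕ) :
    freeD r (phi N u'.1) =
      ∑ u ∈ Finset.univ.filter (fun u : ColWord N ℓ => weight u.1 + (2 * r + 1) = N),
        levelMatrix N ℓ (OrderDual.toDual u') (OrderDual.toDual u) • Finsupp.single u.1 (1 : ℚ) := by
  obtain ⟨h1, h2, h3⟩ := phi_mem u'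
  rw [freeD, if_pos ⟨h1, by omega⟩, h2, h3, freeDAux]
  rfl

/-- **The free (deconcatenation) model of Brown's level data**: `H = ℚ^{(indices)}`, `z w = e_w`,
`D r` = deconcatenation, `E = 0`. It satisfies all the axioms of `LevelData`, which are therefore
consistent. [cite: Brown2012, Theorem 6.1 and §7.2] -/
def freeLevelData : LevelData where
  H := List ℕ →₀ ℚ
  z := fun w => Finsupp.single w 1
  D := fun r => Finsupp.linearCombination ℚ (freeD r)
  level_lowering := by
    intro r N ℓ
    unfold levelSpan
    rw [Submodule.map_span_le]
    rintro _ ⟨w, rfl⟩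
    rw [Finsupp.linearCombination_single, one_smul, freeD]
    split_ifs with hw
    · rw [freeDAux]
      refine Submodule.sum_mem _ fun u hu => Submodule.smul_mem _ _ (Submodule.subset_span ?_)
      rw [Finset.mem_filter] at hu
      have hwt := w.2.2.1
      have hwl := w.2.2.2
      have hul := u.2.2.1
      refine ⟨⟨u.1, u.2.1, by omega, by omega⟩, rfl⟩
    · exact Submodule.zero_mem _
  E := fun _ _ => 0
  E_small := fun _ _ _ _ => Or.inl rfl
  matrix_eq := by
    intro N ℓ hℓ u' r
    rw [Finsupp.linearCombination_single, one_smul, freeD_phi hℓ, add_zero, sub_self]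
    exact Submodule.zero_mem _
  z_replicate_two_ne_zero := fun n => by simp [Finsupp.single_eq_zero]

/-- Theorem 7.4 applies to the free model (where its conclusion is obvious): the wiring of
`LevelData` is exercised end to end. [cite: Brown2012, Theorem 7.4] -/
theorem freeLevelData_linearIndependent (N : ℕ) :
    LinearIndependent ℚ fun w : {w : List ℕ // IsHoffman w ∧ weight w = N} =>
      (Finsupp.single w.1 (1 : ℚ) : List ℕ →₀ ℚ) :=
  freeLevelData.linearIndependent_hoffman N

end Brown2012

end Literature.NumberTheory.Transcendental
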